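import Summits.PneNP.PneNP.Theorems.ChebyshevTracialDesignLowDegreePricing
import HarnessLib

/-!
# Cell pnp-psdrank, route `ChebyshevTracialDesign`: the DEGREE-ONE FACE of the virtual functional — for every perfect matching `M` and every
# exact design of degree `D ≥ 2`, `Σ_U W(U,M)·(v·x_U)² = −(1/|PM|)·[(κ₁−κ₂)·Σ_p v_p(v_p + v_{π_M p}) + κ₂·(Σ_p v_p)²]`, `κ_j = knapsackMoment(n/2,t/2,j)`:
# nonpositive, and ZERO exactly on the pair-antisymmetric vectors (crux `TracialDecayExp20`, stmt-PneNP-19878)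

Brick 98 (prover g18; MEMO-21 §3(c), §5(2β)). The first rung CG_1 of the r-free ladder (MEMO-21 §3(b)) concerns the localised moment matrix
`G^f_M = (Σ_U W(U,M) f(U) x_p x_q)_{p,q}`; its `f ≡ 1` instance is this file's subject, in closed form. With brick 14
(`…LowDegreePricing.lowDegree_rectangle_value_eq`: an exact design prices every test function of degree `≤ D` at Grigoriev's virtual level,
against any set of matchings) and the knapsack pseudo-moments `κ₁ = Ẽ_M[x_p] = Ẽ_M[x_p x_{π p}]`, `κ₂ = Ẽ_M[x_p x_q]` (`q ∉ {p, π p}`):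
* §1 `filter_meets_singleton`, `filter_meets_pair`, `card_filter_meets_pair` — the edges of `M` meeting `{p}` / `{p, q}` (one edge iff
  `q ∈ {p, π_M p}`, else two);
* §2 **`designValue_sq_linear_eq`** — THE IDENTITY above, for every `v : Fin n → ℝ`, every `M`, every exact design with `2 ≤ D`;
  `sum_mul_add_partner_eq` (`Σ_p v_p(v_p+v_{πp}) = ½Σ_p (v_p+v_{πp})²`); **`designValue_sq_linear_nonpos`** (`≤ 0`: the per-matching SIGN cell
  at degree 1 with its constant made explicit, `κ₁ ≥ κ₂ ≥ 0`); **`designValue_sq_linear_eq_zero_of_antisymm`** (`= 0` when `v_{π_M p} = −v_p`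
  for all `p`: the CROSSING LINEAR FORMS `Σ_e v_e(x_p − x_{p'})` are virtually null — the null block in which the whole CG_1 defect of generic
  masks was found numerically, MEMO-21 §7).
So the `n × n` matrix `F_M[1] = Σ_U W(U,M) x_U x_Uᵀ` is `−|PM|⁻¹[(κ₁−κ₂)(I + Π_M) + κ₂ J]`: negative definite with gap `(κ₁−κ₂)/|PM|` on the
pair-symmetric vectors, zero on the pair-antisymmetric ones (`Π_M` the partner permutation) — the `k = 1` face of Grigoriev's form, per matching.
[cite: Grigoriev2001, Lemma 1.4 (PDF p. 8)] [cite: Rothvoss2017, §2 (PDF p. 6)]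
Stature: support/instrument (kernel lane, no defs, axioms standard). WHAT THIS IS NOT: nothing about masks `f ≢ 1` (that is CG_1 itself), no
proof or refutation of `TracialDecayExp20`, nothing on psd rank of P_PM(K_n), no P-vs-NP content. Supports stmt-PneNP-19878.
-/

set_option linter.dupNamespace false -- `Summit.PneNP.PneNP.…`: summit = sub-problem (D-0017)

noncomputable section

namespace Summit.PneNP.PneNP.Theorems.ChebyshevTracialDesignDegreeOneFace

open Finset Literature.Barriers.PneNP Literature.Combinatorics.SimpleGraph.CycleSpace
open Literature.Combinatorics.Optimization Literature.Computability.Complexity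
open Literature.Combinatorics.AssociationSchemes.JohnsonHarmonics
open Summit.PneNP.PneNP.Theorems.ChebyshevTracialDesignLowDegreePricing (lowDegree_rectangle_value_eq)
open Summit.PneNP.PneNP.Theorems.ChebyshevTracialDesignJunta (two_mul_card_pmatch)

variable {n : ℕ}

/-! ### §1 The edges of a perfect matching meeting one or two points -/

/-- The only edge of `M` through `p` is `{p, π p}`. [cite: Rothvoss2017, §2 (PDF p. 6)] -/
theorem filter_meets_singleton (M : PMatch n) (p : Fin n) :
    M.1.filter (fun e => ∃ a ∈ ({p} : Finset (Fin n)), a ∈ e) = {s(p, M.2.partner p)} := by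
  ext e
  simp only [mem_filter, mem_singleton, exists_eq_left]
  constructor
  · rintro ⟨he, hp⟩; exact M.2.eq_mk_partner_of_mem he hp
  · rintro rfl; exact ⟨M.2.mk_partner_mem p, Sym2.mem_mk_left _ _⟩

/-- The edges of `M` meeting `{p, q}` are `{p, πp}` and `{q, πq}`. [cite: Rothvoss2017, §2 (PDF p. 6)] -/
theorem filter_meets_pair (M : PMatch n) (p q : Fin n) :
    M.1.filter (fun e => ∃ a ∈ ({p, q} : Finset (Fin n)), a ∈ e) = {s(p, M.2.partner p), s(q, M.2.partner q)} := by
  ext e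
  simp only [mem_filter, mem_insert, mem_singleton, exists_eq_or_imp, exists_eq_left]
  constructor
  · rintro ⟨he, hp | hq⟩
    · exact Or.inl (M.2.eq_mk_partner_of_mem he hp)
    · exact Or.inr (M.2.eq_mk_partner_of_mem he hq)
  · rintro (rfl | rfl)
    · exact ⟨M.2.mk_partner_mem p, Or.inl (Sym2.mem_mk_left _ _)⟩
    · exact ⟨M.2.mk_partner_mem q, Or.inr (Sym2.mem_mk_left _ _)⟩

/-- `{p, πp} = {q, πq}` iff `q ∈ {p, πp}`. [folklore] -/
theorem mk_partner_eq_iff (M : PMatch n) (p q : Fin n) :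
    s(p, M.2.partner p) = s(q, M.2.partner q) ↔ (q = p ∨ q = M.2.partner p) := by
  constructor
  · intro h
    have hq : q ∈ s(p, M.2.partner p) := by rw [h]; exact Sym2.mem_mk_left _ _
    rcases Sym2.mem_iff.1 hq with h1 | h1
    · exact Or.inl h1
    · exact Or.inr h1
  · rintro (rfl | rfl)
    · rfl
    · rw [M.2.partner_partner, Sym2.eq_swap]

/-- `|M[{p,q}]| = 1` if `q ∈ {p, πp}`, else `2`. [cite: Rothvoss2017, §2 (PDF p. 6)] -/
theorem card_filter_meets_pair (M : PMatch n) (p q : Fin n) :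
    (M.1.filter (fun e => ∃ a ∈ ({p, q} : Finset (Fin n)), a ∈ e)).card = if (q = p ∨ q = M.2.partner p) then 1 else 2 := by
  rw [filter_meets_pair]
  by_cases h : q = p ∨ q = M.2.partner p
  · rw [if_pos h, ← (mk_partner_eq_iff M p q).2 h, pair_eq_singleton, card_singleton]
  · rw [if_neg h, card_pair]
    exact fun he => h ((mk_partner_eq_iff M p q).1 he)

/-! ### §2 The degree-one face -/

/-- `Σ_p v_p (v_p + v_{πp}) = ½ Σ_p (v_p + v_{πp})²` for the fixed-point-free involution `π = π_M`. [folklore] -/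
theorem sum_mul_add_partner_eq (M : PMatch n) (v : Fin n → ℝ) :
    ∑ p, v p * (v p + v (M.2.partner p)) = (1 / 2) * ∑ p, (v p + v (M.2.partner p)) ^ 2 := by
  -- `π` is a bijection, so `Σ_p g(πp) = Σ_p g(p)`
  set π : Equiv.Perm (Fin n) := Function.Involutive.toPerm (M.2.partner) (fun p => M.2.partner_partner p) with hπ
  have hswap : ∑ p, v (M.2.partner p) * (v (M.2.partner p) + v p) = ∑ p, v p * (v p + v (M.2.partner p)) := by
    have := Equiv.sum_comp π (fun p => v p * (v p + v (M.2.partner p)))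
    simpa only [hπ, Function.Involutive.coe_toPerm, M.2.partner_partner] using this
  have e : ∑ p, (v p + v (M.2.partner p)) ^ 2 = ∑ p, v p * (v p + v (M.2.partner p)) + ∑ p, v (M.2.partner p) * (v (M.2.partner p) + v p) := by
    rw [← sum_add_distrib]; exact sum_congr rfl fun p _ => by ring
  rw [e, hswap]; ring

/-- **THE DEGREE-ONE FACE OF THE VIRTUAL FUNCTIONAL.** For an exact design `(n, t, T, D, B_v, C, w)` with `2 ≤ D`, every perfect matching `M`
and every `v : Fin n → ℝ`:
`Σ_U W(U,M)·(Σ_p v_p x_p(U))² = −|PM|⁻¹·[(κ₁ − κ₂)·Σ_p v_p(v_p + v_{π_M p}) + κ₂·(Σ_p v_p)²]`, `κ_j = knapsackMoment(|M|, t/2, j)`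
(`κ₁ = (t/2)/(n/2)`, `κ₂ = (t/2)(t/2−1)/((n/2)(n/2−1))`). [cite: Grigoriev2001, Lemma 1.4 (PDF p. 8)] [cite: Rothvoss2017, §2 (PDF p. 6)] -/
theorem designValue_sq_linear_eq {t T D : ℕ} {Bv : ℝ} {C : Finset ℕ} {w : ℕ → ℝ} (hdes : IsExactDesign n t T D Bv C w) (hD : 2 ≤ D)
    (M : PMatch n) (v : Fin n → ℝ) :
    ∑ U : OddSet n, levelWeight n t C w U M * (∑ p, v p * (if p ∈ U.1 then (1 : ℝ) else 0)) ^ 2 =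
      -((Fintype.card (PMatch n) : ℝ)⁻¹ *
        ((knapsackMoment M.1.card ((t : ℝ) / 2) 1 - knapsackMoment M.1.card ((t : ℝ) / 2) 2) * (∑ p, v p * (v p + v (M.2.partner p))) +
          knapsackMoment M.1.card ((t : ℝ) / 2) 2 * (∑ p, v p) ^ 2)) := by
  classical
  -- the coefficient vector of the square: `Q(A) = Σ_{p,q : {p,q} = A} v_p v_q`
  set Q : Finset (Fin n) → ℝ := fun A => ∑ p, ∑ q, if A = ({p, q} : Finset (Fin n)) then v p * v q else 0 with hQ
  have hQsupp : ∀ A : Finset (Fin n), D < A.card → Q A = 0 := by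
    intro A hA
    refine sum_eq_zero fun p _ => sum_eq_zero fun q _ => ?_
    rw [if_neg]
    rintro rfl
    have := card_insert_le p ({q} : Finset (Fin n))
    rw [card_singleton] at this
    omega
  -- `zeta Q U = (Σ_p v_p x_p(U))²`
  have hzeta : ∀ U : Finset (Fin n), zeta Q U = (∑ p, v p * (if p ∈ U then (1 : ℝ) else 0)) ^ 2 := by
    intro U
    rw [zeta_apply, sq, sum_mul_sum]
    simp only [hQ]
    rw [sum_comm]
    refine sum_congr rfl fun p _ => ?_
    rw [sum_comm]
    refine sum_congr rfl fun q _ => ?_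
    rw [sum_ite_eq' (U.powerset) ({p, q} : Finset (Fin n)) (fun _ => v p * v q)]
    by_cases hp : p ∈ U <;> by_cases hq : q ∈ U <;> simp [hp, hq, mem_powerset, insert_subset_iff]
  -- brick 14 with `Y = {M}`
  have h14 := lowDegree_rectangle_value_eq hdes Q hQsupp {M}
  simp only [sum_singleton] at h14
  simp_rw [hzeta] at h14
  rw [h14]
  congr 2
  -- evaluate the virtual value `Σ_A Q(A)·κ_{|M[A]|}`
  have hsub : ∀ p q : Fin n, ({p, q} : Finset (Fin n)).card ≤ D := fun p q =>
    (card_insert_le p {q}).trans (by rw [card_singleton]; omega)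
  have hexp : ∑ A : {A : Finset (Fin n) // A.card ≤ D},
      Q A.1 * knapsackMoment M.1.card ((t : ℝ) / 2) (M.1.filter fun e => ∃ a ∈ A.1, a ∈ e).card =
      ∑ p, ∑ q, v p * v q * knapsackMoment M.1.card ((t : ℝ) / 2) (M.1.filter fun e => ∃ a ∈ ({p, q} : Finset (Fin n)), a ∈ e).card := by
    simp only [hQ, sum_mul]
    rw [sum_comm]
    refine sum_congr rfl fun p _ => ?_
    rw [sum_comm]
    refine sum_congr rfl fun q _ => ?_
    rw [Fintype.sum_eq_single (⟨{p, q}, hsub p q⟩ : {A : Finset (Fin n) // A.card ≤ D})]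
    · simp
    · intro A hA
      rw [if_neg, zero_mul]
      intro h
      exact hA (Subtype.ext h)
  rw [hexp]
  simp_rw [card_filter_meets_pair]
  -- split `κ(p,q) = κ₂ + [q = p](κ₁ − κ₂) + [q = πp](κ₁ − κ₂)` (the two events are disjoint)
  set κ₁ := knapsackMoment M.1.card ((t : ℝ) / 2) 1
  set κ₂ := knapsackMoment M.1.card ((t : ℝ) / 2) 2
  have hsplit : ∀ p q : Fin n, v p * v q * knapsackMoment M.1.card ((t : ℝ) / 2) (if (q = p ∨ q = M.2.partner p) then 1 else 2) =
      κ₂ * (v p * v q) + (if q = p then (κ₁ - κ₂) * (v p * v q) else 0) + (if q = M.2.partner p then (κ₁ - κ₂) * (v p * v q) else 0) := by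
    intro p q
    have hne : M.2.partner p ≠ p := M.2.partner_ne p
    by_cases h1 : q = p
    · subst h1
      rw [if_pos (Or.inl rfl), if_pos rfl, if_neg hne.symm]; ring
    · by_cases h2 : q = M.2.partner p
      · rw [if_pos (Or.inr h2), if_neg h1, if_pos h2]; ring
      · rw [if_neg (by tauto), if_neg h1, if_neg h2]; ring
  simp_rw [hsplit, sum_add_distrib, sum_ite_eq', mem_univ, if_true, ← mul_sum, ← sum_mul]
  rw [sq, sum_mul_sum]
  simp_rw [mul_add, sum_add_distrib, ← mul_sum]
  ring

/-- **THE DEGREE-ONE FACE IS NONPOSITIVE** (per-matching SIGN at degree 1, explicit): `Σ_U W(U,M)(v·x_U)² ≤ 0` for `2 ≤ D`.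
[cite: Grigoriev2001, Lemma 1.4 (PDF p. 8)] [cite: Rothvoss2017, §2 (PDF p. 6)] -/
theorem designValue_sq_linear_nonpos {t T D : ℕ} {Bv : ℝ} {C : Finset ℕ} {w : ℕ → ℝ} (hdes : IsExactDesign n t T D Bv C w) (hD : 2 ≤ D)
    (M : PMatch n) (v : Fin n → ℝ) :
    ∑ U : OddSet n, levelWeight n t C w U M * (∑ p, v p * (if p ∈ U.1 then (1 : ℝ) else 0)) ^ 2 ≤ 0 := by
  rw [designValue_sq_linear_eq hdes hD M v, sum_mul_add_partner_eq, neg_nonpos]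
  have hN : M.1.card = n / 2 := by have := two_mul_card_pmatch M; omega
  obtain ⟨htodd, htn, hTt, hC, hnorm, -, -⟩ := hdes
  -- `t ≥ 3`: the design is supported on levels `c ≥ 3`, `c ≤ T ≤ t`, and `Σ w_c (c−1) = 1` forces `C ≠ ∅`
  have hCne : C.Nonempty := by
    by_contra h
    rw [not_nonempty_iff_eq_empty] at h
    rw [h, sum_empty] at hnorm
    exact zero_ne_one hnorm
  obtain ⟨c₀, hc₀⟩ := hCne
  have ht3 : 3 ≤ t := by have := (hC c₀ hc₀).2.1; have := (hC c₀ hc₀).2.2.1; omega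
  -- the two pseudo-moments
  have hm2 : (2 : ℝ) ≤ (M.1.card : ℝ) := by
    have : 2 ≤ M.1.card := by omega
    exact_mod_cast this
  have ht' : (t : ℝ) / 2 ≤ (M.1.card : ℝ) := by
    have : t ≤ 2 * M.1.card := by omega
    have : (t : ℝ) ≤ 2 * (M.1.card : ℝ) := by exact_mod_cast this
    linarith
  have ht3' : (3 : ℝ) ≤ t := by exact_mod_cast ht3
  have hκ₁ : knapsackMoment M.1.card ((t : ℝ) / 2) 1 = ((t : ℝ) / 2) / (M.1.card : ℝ) := by
    simp only [knapsackMoment, Finset.prod_range_succ, Finset.prod_range_zero, Nat.cast_zero, sub_zero, one_mul]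
  have hκ₂ : knapsackMoment M.1.card ((t : ℝ) / 2) 2 = ((t : ℝ) / 2) / (M.1.card : ℝ) * (((t : ℝ) / 2 - 1) / ((M.1.card : ℝ) - 1)) := by
    simp only [knapsackMoment, Finset.prod_range_succ, Finset.prod_range_zero, Nat.cast_zero, Nat.cast_one, sub_zero, one_mul]
  have hκ₂0 : 0 ≤ knapsackMoment M.1.card ((t : ℝ) / 2) 2 := by
    rw [hκ₂]; apply mul_nonneg <;> apply div_nonneg <;> linarith
  have hκ12 : 0 ≤ knapsackMoment M.1.card ((t : ℝ) / 2) 1 - knapsackMoment M.1.card ((t : ℝ) / 2) 2 := by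
    rw [hκ₁, hκ₂, ← mul_one_sub]
    apply mul_nonneg (div_nonneg (by linarith) (by linarith))
    rw [sub_nonneg, div_le_one (by linarith)]
    linarith
  have hPm : 0 ≤ (Fintype.card (PMatch n) : ℝ)⁻¹ := inv_nonneg.2 (Nat.cast_nonneg _)
  have hS : 0 ≤ (1 / 2 : ℝ) * ∑ p, (v p + v (M.2.partner p)) ^ 2 := by positivity
  have hT : 0 ≤ (∑ p, v p) ^ 2 := sq_nonneg _
  exact mul_nonneg hPm (add_nonneg (mul_nonneg hκ12 hS) (mul_nonneg hκ₂0 hT))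

/-- **THE CROSSING LINEAR FORMS ARE VIRTUALLY NULL**: if `v_{π_M p} = −v_p` for all `p` (pair-antisymmetric `v`, i.e. `v·x_U = Σ_{e∈M} v_e(x_p − x_{p'})`),
then `Σ_U W(U,M)(v·x_U)² = 0` — for every exact design with `2 ≤ D`. [cite: Grigoriev2001, Lemma 1.4 (PDF p. 8)] [cite: Rothvoss2017, §2 (PDF p. 6)] -/
theorem designValue_sq_linear_eq_zero_of_antisymm {t T D : ℕ} {Bv : ℝ} {C : Finset ℕ} {w : ℕ → ℝ} (hdes : IsExactDesign n t T D Bv C w)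
    (hD : 2 ≤ D) (M : PMatch n) (v : Fin n → ℝ) (hv : ∀ p, v (M.2.partner p) = -v p) :
    ∑ U : OddSet n, levelWeight n t C w U M * (∑ p, v p * (if p ∈ U.1 then (1 : ℝ) else 0)) ^ 2 = 0 := by
  rw [designValue_sq_linear_eq hdes hD M v]
  have h1 : ∑ p, v p * (v p + v (M.2.partner p)) = 0 := sum_eq_zero fun p _ => by rw [hv p]; ring
  have h2 : ∑ p, v p = 0 := by
    set π : Equiv.Perm (Fin n) := Function.Involutive.toPerm (M.2.partner) (fun p => M.2.partner_partner p) with hπ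
    have hswap : ∑ p, v (M.2.partner p) = ∑ p, v p := by
      have := Equiv.sum_comp π v
      simpa only [hπ, Function.Involutive.coe_toPerm] using this
    simp_rw [hv, sum_neg_distrib] at hswap
    linarith
  rw [h1, h2]; ring

end Summit.PneNP.PneNP.Theorems.ChebyshevTracialDesignDegreeOneFace

end
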